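import Mathlib
import Summits.PneNP.PneNP.Theses.OverlapGapAlgebra
import Summits.PneNP.PneNP.Theorems.OverlapGapAlgebraSolvableImpliesStableSectionEtaGeOne
import Summits.PneNP.PneNP.Theorems.OverlapGapAlgebraSolvableImpliesStableSectionConstSection
import Summits.PneNP.PneNP.Theorems.OverlapGapAlgebraSolvableImpliesStableSectionFirstMoment
import Summits.PneNP.PneNP.Theorems.OverlapGapAlgebraSolvableImpliesStableSectionTwoWayRepairAssembly

/-!
# `SolvableImpliesStableSection` from its regime split (children G / M / T)

Support for item stmt-PneNP-2463 (route OverlapGapAlgebra).  The strategist's line `RegimeSplit`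
(Cruxes/SolvableImpliesStableSection/Lines/RegimeSplit.lean, 2026-08-17) cuts the crux's residual at the
two natural algorithmic thresholds of random k-SAT into three statements:

* **G** — f-free stable sections for `0 < α < 2^k/k` (the Unit-Clause regime), every `k ≥ 3`, all `η ν c`;
* **M** — the same for `2^k/k ≤ α < 2^k log k/k` (the unclustered strip);
* **T** — the crux verbatim on the core `2^k log k/k ≤ α < 2^k log 2`, `η < 1`, `ν ≤ 2^{-k}` (the bet).

This file lands the glue as theorems of the tree (the skeleton's composition `SolvableImpliesStableSection_of`
with the stubs turned into hypotheses), so that the prepared route-level split can cite it: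

* `sissS_solvableImpliesStableSection_of_split` : `G → M → T → SolvableImpliesStableSection`;
* `sissS_lowDensity_of_density_le` : the part of **G** with `4kα ≤ 2^k` is already a theorem
  (`sissW_conclusion_of_density_le`, two-way repair), stated in **G**'s own currency;
* `sissS_solvableImpliesStableSection_of_split'` : hence only **G₂** = **G** on `2^k/(4k) < α < 2^k/k`
  is owed: `G₂ → M → T → SolvableImpliesStableSection`;
* `sissS_core_of_solvableImpliesStableSection` : conversely the crux gives **T** (T is a restriction, not a
  strengthening).

The other regimes are the tree's: `α ≥ 2^k log 2` (hypothesis false, `sissFM_hyp_false_of_density_ge_log_two`),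
`η ≥ 1` (`solvableImpliesStableSection_of_eta_ge_one`), `ν > 2^{-k}` (`solvableImpliesStableSection_of_nu_gt`).
-/

set_option linter.dupNamespace false

namespace Summit.PneNP.PneNP.Theorems

open Finset

/-- **The crux from its three children.**  If (G) f-free stable sections exist below `2^k/k`, (M) on
`[2^k/k, 2^k log k/k)`, and (T) the transfer holds on the core `[2^k log k/k, 2^k log 2) × {η < 1} × {ν ≤ 2^{-k}}`,
then `SolvableImpliesStableSection` holds: the remaining regimes are `α ≥ 2^k log 2` (the solvability
hypothesis is false by the first moment), `η ≥ 1` and `ν > 2^{-k}` (landed theorems). -/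
theorem sissS_solvableImpliesStableSection_of_split
    (hG : ∀ k : ℕ, 3 ≤ k → ∀ α η ν : ℝ, 0 < α → α < 2 ^ k / k → 0 < η → 0 < ν → ∀ c : ℝ, 0 < c →
      ∀ᶠ n : ℕ in Filter.atTop, ∀ m : ℕ, m = ⌊α * n⌋₊ →
        ∃ g : (Fin m → Fin k → Fin n × Bool) → (Fin n → Bool),
          Real.exp (-(c * n)) * Fintype.card (Fin (k + 1) → Fin m → Fin k → Fin n × Bool) ≤
          ((Finset.univ.filter fun Ψ : Fin (k + 1) → Fin m → Fin k → Fin n × Bool =>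
            let P : Fin k → ℕ → Fin m → Fin k → Fin n × Bool :=
              fun r q a b => if (a : ℕ) * k + b < q then Ψ r.succ a b else Ψ r.castSucc a b
            (∀ r : Fin k, ∀ q ≤ m * k, ((Finset.univ.filter fun i : Fin m =>
              ∀ j, g (P r q) (P r q i j).1 ≠ (P r q i j).2).card : ℝ) ≤ ν * m) ∧
            ∀ r : Fin k, ∀ q < m * k,
              (hammingDist (g (P r q)) (g (P r (q + 1))) : ℝ) ≤ η * n).card : ℝ))
    (hM : ∀ k : ℕ, 3 ≤ k → ∀ α η ν : ℝ, 2 ^ k / k ≤ α → α < 2 ^ k * Real.log k / k → 0 < η → 0 < ν →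
      ∀ c : ℝ, 0 < c → ∀ᶠ n : ℕ in Filter.atTop, ∀ m : ℕ, m = ⌊α * n⌋₊ →
        ∃ g : (Fin m → Fin k → Fin n × Bool) → (Fin n → Bool),
          Real.exp (-(c * n)) * Fintype.card (Fin (k + 1) → Fin m → Fin k → Fin n × Bool) ≤
          ((Finset.univ.filter fun Ψ : Fin (k + 1) → Fin m → Fin k → Fin n × Bool =>
            let P : Fin k → ℕ → Fin m → Fin k → Fin n × Bool :=
              fun r q a b => if (a : ℕ) * k + b < q then Ψ r.succ a b else Ψ r.castSucc a b
            (∀ r : Fin k, ∀ q ≤ m * k, ((Finset.univ.filter fun i : Fin m =>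
              ∀ j, g (P r q) (P r q i j).1 ≠ (P r q i j).2).card : ℝ) ≤ ν * m) ∧
            ∀ r : Fin k, ∀ q < m * k,
              (hammingDist (g (P r q)) (g (P r (q + 1))) : ℝ) ≤ η * n).card : ℝ))
    (hT : ∀ k : ℕ, 3 ≤ k → ∀ α η ν : ℝ, 2 ^ k * Real.log k / k ≤ α → α < 2 ^ k * Real.log 2 →
      0 < η → η < 1 → 0 < ν → ν ≤ (1 / 2 : ℝ) ^ k →
      (∃ f : List Bool → List Bool, Literature.Computability.Complexity.IsPolyTime f ∧
        ∃ ε : ℝ, 0 < ε ∧ ∃ᶠ n : ℕ in Filter.atTop, ∀ m : ℕ, m = ⌊α * n⌋₊ → ε ≤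
          ((Finset.univ.filter fun Φ : Fin m → Fin k → Fin n × Bool => ∀ i, ∃ j,
            (f (Literature.Computability.Complexity.encodingCNF.encode (List.ofFn fun a =>
              List.ofFn fun b => (((Φ a b).1 : ℕ), (Φ a b).2)))).getD (Φ i j).1 false =
                (Φ i j).2).card : ℝ) / Fintype.card (Fin m → Fin k → Fin n × Bool)) →
      ∀ c : ℝ, 0 < c → ∃ᶠ n : ℕ in Filter.atTop, ∀ m : ℕ, m = ⌊α * n⌋₊ →
        ∃ g : (Fin m → Fin k → Fin n × Bool) → (Fin n → Bool),
          Real.exp (-(c * n)) * Fintype.card (Fin (k + 1) → Fin m → Fin k → Fin n × Bool) ≤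
          ((Finset.univ.filter fun Ψ : Fin (k + 1) → Fin m → Fin k → Fin n × Bool =>
            let P : Fin k → ℕ → Fin m → Fin k → Fin n × Bool :=
              fun r q a b => if (a : ℕ) * k + b < q then Ψ r.succ a b else Ψ r.castSucc a b
            (∀ r : Fin k, ∀ q ≤ m * k, ((Finset.univ.filter fun i : Fin m =>
              ∀ j, g (P r q) (P r q i j).1 ≠ (P r q i j).2).card : ℝ) ≤ ν * m) ∧
            ∀ r : Fin k, ∀ q < m * k,
              (hammingDist (g (P r q)) (g (P r (q + 1))) : ℝ) ≤ η * n).card : ℝ)) :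
    Summit.PneNP.PneNP.Theses.OverlapGapAlgebra.SolvableImpliesStableSection := by
  unfold Summit.PneNP.PneNP.Theses.OverlapGapAlgebra.SolvableImpliesStableSection
  intro k hk α η ν hα hη hν hsolv c hc
  have hk1 : 1 ≤ k := by omega
  -- (G) the Unit-Clause regime `α < 2^k/k`
  by_cases h1 : α < 2 ^ k / k
  · exact (hG k hk α η ν hα h1 hη hν c hc).frequently
  -- (M) the unclustered strip `2^k/k ≤ α < 2^k log k/k`
  by_cases h2 : α < 2 ^ k * Real.log k / k
  · exact (hM k hk α η ν (not_lt.mp h1) h2 hη hν c hc).frequently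
  -- `α ≥ 2^k log 2`: the hypothesis is false (first moment)
  by_cases h3 : (2 : ℝ) ^ k * Real.log 2 ≤ α
  · exact absurd hsolv (sissFM_hyp_false_of_density_ge_log_two k hk1 α h3)
  -- `η ≥ 1`: stability is vacuous, validity by the arg-max-sat boost
  by_cases h4 : 1 ≤ η
  · obtain ⟨f, -, ε, hε, hfreq⟩ := hsolv
    exact Summit.PneNP.PneNP.Cruxes.SolvableImpliesStableSection.Sketch.solvableImpliesStableSection_of_eta_ge_one
      k hk1 α η ν hα h4 hν ⟨f, ε, hε, hfreq⟩ c hc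
  -- `ν > 2^{-k}`: the constant section
  by_cases h5 : (1 / 2 : ℝ) ^ k < ν
  · exact Summit.PneNP.PneNP.Cruxes.SolvableImpliesStableSection.Sketch.solvableImpliesStableSection_of_nu_gt
      k hk1 α η ν hα hη h5 c hc
  -- (T) the core
  exact hT k hk α η ν (not_lt.mp h2) (not_le.mp h3) hη (not_le.mp h4) hν (not_lt.mp h5) hsolv c hc

/-- **The low quarter of child G is a theorem.**  For every `k ≥ 3`, every `0 < α` with `4kα ≤ 2^k` and all
`η, ν, c > 0`, the conclusion of child G holds (eventually in `n`): this is `sissW_conclusion_of_density_le`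
(Λ-round two-way repair with one-round memory), restated in G's currency. -/
theorem sissS_lowDensity_of_density_le :
    ∀ k : ℕ, 3 ≤ k → ∀ α η ν : ℝ, 0 < α → α * (4 * k) ≤ (2 : ℝ) ^ k → 0 < η → 0 < ν → ∀ c : ℝ, 0 < c →
      ∀ᶠ n : ℕ in Filter.atTop, ∀ m : ℕ, m = ⌊α * n⌋₊ →
        ∃ g : (Fin m → Fin k → Fin n × Bool) → (Fin n → Bool),
          Real.exp (-(c * n)) * Fintype.card (Fin (k + 1) → Fin m → Fin k → Fin n × Bool) ≤
          ((Finset.univ.filter fun Ψ : Fin (k + 1) → Fin m → Fin k → Fin n × Bool =>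
            let P : Fin k → ℕ → Fin m → Fin k → Fin n × Bool :=
              fun r q a b => if (a : ℕ) * k + b < q then Ψ r.succ a b else Ψ r.castSucc a b
            (∀ r : Fin k, ∀ q ≤ m * k, ((Finset.univ.filter fun i : Fin m =>
              ∀ j, g (P r q) (P r q i j).1 ≠ (P r q i j).2).card : ℝ) ≤ ν * m) ∧
            ∀ r : Fin k, ∀ q < m * k,
              (hammingDist (g (P r q)) (g (P r (q + 1))) : ℝ) ≤ η * n).card : ℝ) :=
  fun k hk α η ν hα hαk hη hν c hc => sissW_conclusion_of_density_le k hk α η ν hα hαk hη hν c hc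

/-- **The crux from G₂, M, T.**  Since the part `4kα ≤ 2^k` of child G is proved
(`sissS_lowDensity_of_density_le`), child G is only owed on `2^k/(4k) < α < 2^k/k` (hypothesis `hG₂`,
stated as `2^k < 4kα`); with M and T as in `sissS_solvableImpliesStableSection_of_split` this gives the crux. -/
theorem sissS_solvableImpliesStableSection_of_split'
    (hG₂ : ∀ k : ℕ, 3 ≤ k → ∀ α η ν : ℝ, 0 < α → (2 : ℝ) ^ k < α * (4 * k) → α < 2 ^ k / k →
      0 < η → 0 < ν → ∀ c : ℝ, 0 < c →
      ∀ᶠ n : ℕ in Filter.atTop, ∀ m : ℕ, m = ⌊α * n⌋₊ →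
        ∃ g : (Fin m → Fin k → Fin n × Bool) → (Fin n → Bool),
          Real.exp (-(c * n)) * Fintype.card (Fin (k + 1) → Fin m → Fin k → Fin n × Bool) ≤
          ((Finset.univ.filter fun Ψ : Fin (k + 1) → Fin m → Fin k → Fin n × Bool =>
            let P : Fin k → ℕ → Fin m → Fin k → Fin n × Bool :=
              fun r q a b => if (a : ℕ) * k + b < q then Ψ r.succ a b else Ψ r.castSucc a b
            (∀ r : Fin k, ∀ q ≤ m * k, ((Finset.univ.filter fun i : Fin m =>
              ∀ j, g (P r q) (P r q i j).1 ≠ (P r q i j).2).card : ℝ) ≤ ν * m) ∧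
            ∀ r : Fin k, ∀ q < m * k,
              (hammingDist (g (P r q)) (g (P r (q + 1))) : ℝ) ≤ η * n).card : ℝ))
    (hM : ∀ k : ℕ, 3 ≤ k → ∀ α η ν : ℝ, 2 ^ k / k ≤ α → α < 2 ^ k * Real.log k / k → 0 < η → 0 < ν →
      ∀ c : ℝ, 0 < c → ∀ᶠ n : ℕ in Filter.atTop, ∀ m : ℕ, m = ⌊α * n⌋₊ →
        ∃ g : (Fin m → Fin k → Fin n × Bool) → (Fin n → Bool),
          Real.exp (-(c * n)) * Fintype.card (Fin (k + 1) → Fin m → Fin k → Fin n × Bool) ≤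
          ((Finset.univ.filter fun Ψ : Fin (k + 1) → Fin m → Fin k → Fin n × Bool =>
            let P : Fin k → ℕ → Fin m → Fin k → Fin n × Bool :=
              fun r q a b => if (a : ℕ) * k + b < q then Ψ r.succ a b else Ψ r.castSucc a b
            (∀ r : Fin k, ∀ q ≤ m * k, ((Finset.univ.filter fun i : Fin m =>
              ∀ j, g (P r q) (P r q i j).1 ≠ (P r q i j).2).card : ℝ) ≤ ν * m) ∧
            ∀ r : Fin k, ∀ q < m * k,
              (hammingDist (g (P r q)) (g (P r (q + 1))) : ℝ) ≤ η * n).card : ℝ))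
    (hT : ∀ k : ℕ, 3 ≤ k → ∀ α η ν : ℝ, 2 ^ k * Real.log k / k ≤ α → α < 2 ^ k * Real.log 2 →
      0 < η → η < 1 → 0 < ν → ν ≤ (1 / 2 : ℝ) ^ k →
      (∃ f : List Bool → List Bool, Literature.Computability.Complexity.IsPolyTime f ∧
        ∃ ε : ℝ, 0 < ε ∧ ∃ᶠ n : ℕ in Filter.atTop, ∀ m : ℕ, m = ⌊α * n⌋₊ → ε ≤
          ((Finset.univ.filter fun Φ : Fin m → Fin k → Fin n × Bool => ∀ i, ∃ j,
            (f (Literature.Computability.Complexity.encodingCNF.encode (List.ofFn fun a =>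
              List.ofFn fun b => (((Φ a b).1 : ℕ), (Φ a b).2)))).getD (Φ i j).1 false =
                (Φ i j).2).card : ℝ) / Fintype.card (Fin m → Fin k → Fin n × Bool)) →
      ∀ c : ℝ, 0 < c → ∃ᶠ n : ℕ in Filter.atTop, ∀ m : ℕ, m = ⌊α * n⌋₊ →
        ∃ g : (Fin m → Fin k → Fin n × Bool) → (Fin n → Bool),
          Real.exp (-(c * n)) * Fintype.card (Fin (k + 1) → Fin m → Fin k → Fin n × Bool) ≤
          ((Finset.univ.filter fun Ψ : Fin (k + 1) → Fin m → Fin k → Fin n × Bool =>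
            let P : Fin k → ℕ → Fin m → Fin k → Fin n × Bool :=
              fun r q a b => if (a : ℕ) * k + b < q then Ψ r.succ a b else Ψ r.castSucc a b
            (∀ r : Fin k, ∀ q ≤ m * k, ((Finset.univ.filter fun i : Fin m =>
              ∀ j, g (P r q) (P r q i j).1 ≠ (P r q i j).2).card : ℝ) ≤ ν * m) ∧
            ∀ r : Fin k, ∀ q < m * k,
              (hammingDist (g (P r q)) (g (P r (q + 1))) : ℝ) ≤ η * n).card : ℝ)) :
    Summit.PneNP.PneNP.Theses.OverlapGapAlgebra.SolvableImpliesStableSection := by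
  refine sissS_solvableImpliesStableSection_of_split ?_ hM hT
  intro k hk α η ν hα h1 hη hν c hc
  by_cases hq : α * (4 * k) ≤ (2 : ℝ) ^ k
  · exact sissS_lowDensity_of_density_le k hk α η ν hα hq hη hν c hc
  · exact hG₂ k hk α η ν hα (not_le.mp hq) h1 hη hν c hc

/-- **Child T is a restriction of the crux** (so the split does not strengthen the bet): the crux gives T. -/
theorem sissS_core_of_solvableImpliesStableSection
    (h : Summit.PneNP.PneNP.Theses.OverlapGapAlgebra.SolvableImpliesStableSection) :
    ∀ k : ℕ, 3 ≤ k → ∀ α η ν : ℝ, 2 ^ k * Real.log k / k ≤ α → α < 2 ^ k * Real.log 2 →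
      0 < η → η < 1 → 0 < ν → ν ≤ (1 / 2 : ℝ) ^ k →
      (∃ f : List Bool → List Bool, Literature.Computability.Complexity.IsPolyTime f ∧
        ∃ ε : ℝ, 0 < ε ∧ ∃ᶠ n : ℕ in Filter.atTop, ∀ m : ℕ, m = ⌊α * n⌋₊ → ε ≤
          ((Finset.univ.filter fun Φ : Fin m → Fin k → Fin n × Bool => ∀ i, ∃ j,
            (f (Literature.Computability.Complexity.encodingCNF.encode (List.ofFn fun a =>
              List.ofFn fun b => (((Φ a b).1 : ℕ), (Φ a b).2)))).getD (Φ i j).1 false =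
                (Φ i j).2).card : ℝ) / Fintype.card (Fin m → Fin k → Fin n × Bool)) →
      ∀ c : ℝ, 0 < c → ∃ᶠ n : ℕ in Filter.atTop, ∀ m : ℕ, m = ⌊α * n⌋₊ →
        ∃ g : (Fin m → Fin k → Fin n × Bool) → (Fin n → Bool),
          Real.exp (-(c * n)) * Fintype.card (Fin (k + 1) → Fin m → Fin k → Fin n × Bool) ≤
          ((Finset.univ.filter fun Ψ : Fin (k + 1) → Fin m → Fin k → Fin n × Bool =>
            let P : Fin k → ℕ → Fin m → Fin k → Fin n × Bool :=
              fun r q a b => if (a : ℕ) * k + b < q then Ψ r.succ a b else Ψ r.castSucc a b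
            (∀ r : Fin k, ∀ q ≤ m * k, ((Finset.univ.filter fun i : Fin m =>
              ∀ j, g (P r q) (P r q i j).1 ≠ (P r q i j).2).card : ℝ) ≤ ν * m) ∧
            ∀ r : Fin k, ∀ q < m * k,
              (hammingDist (g (P r q)) (g (P r (q + 1))) : ℝ) ≤ η * n).card : ℝ) := by
  intro k hk α η ν hαlo hαhi hη _hη1 hν _hνk hsolv c hc
  have hk1 : (3 : ℝ) ≤ k := by exact_mod_cast hk
  have hlogk : 0 < Real.log k := Real.log_pos (by linarith)
  have hα : 0 < α := lt_of_lt_of_le (by positivity) hαlo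
  exact h k hk α η ν hα hη hν hsolv c hc

end Summit.PneNP.PneNP.Theorems
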